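import Mathlib.MeasureTheory.Measure.Hausdorff
import Mathlib.Topology.MetricSpace.HausdorffDimension
import Literature.Analysis.FluidPDE.WeakSolution
import Literature.Analysis.FluidPDE.DissipationAnomaly
import HarnessLib

/-!
# Barrier (AnomalousDissipation): anomalous dissipation of bounded flows cannot live on sets
of space–time dimension below that of space (De Rosa–Drivas–Inversi)
(D-0021 barrier catalogue for `Summits/AnomalousDissipation`; summit statement
`AnomalousDissipation := Literature.Turb.ZerothLaw`; companion to the intermittency barrier
`DeRosaIsett2024_thm213` of `IntermittentDissipation.lean`, which bounds regularity *given* a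
small dissipation support — here the support itself is bounded from below)

De Rosa–Drivas–Inversi, *On the support of anomalous dissipation measures*, J. Math. Fluid
Mech. 26 (2024) (arXiv:2301.09603; numbering of the arXiv version), Thm. 1.2 (Incompressible
Euler): for `3 ≤ r, q ≤ ∞`, `s = d(r-2)/r - 2(r+d)/((q-1)r) ≥ 0`, `α = q(r+d)/((q-1)r)` ("with
`s = d` and `α = 1` whenever `r, q = ∞`"), if `u ∈ L^q_loc(0,T; L^r_loc(Ω))` and
`p ∈ L^{q/2}_loc(0,T; L^{r/2}_loc(Ω))` form a weak solution of the incompressible Euler equations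
with non-negative local anomalous dissipation measure
`ε[u] = -∂ₜ(½|u|²) - div((½|u|² + p)u) ∈ M_loc(Ω × (0,T))`, then `ε[u] ≪ H^s_α` (anisotropic
space–time Hausdorff measure; `H^s_1 = H^s`), and if `ε[u]` is non-trivial and concentrated on
a space–time set `S` then `dim_{H_α} S ≥ s`. "One implication of our results is that any
bounded Euler solution … arising as a zero viscosity limit of Navier–Stokes solutions cannot
have anomalous dissipation supported on a set of dimension smaller than that of the space. This
result is sharp, as demonstrated by … recent constructions of dissipative incompressible Euler
solutions [Bruè–De Lellis 2023; BCCDS 2024]" (op. cit. Abstract), for which "all dissipation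
happens at the single instant `T`" (op. cit. §1).

## What is vendored

* `DeRosaDrivasInversi2024_thm12_bounded` — Thm. 1.2 in the bounded case `r = q = ∞` (`s = d`,
  `α = 1`: the *isotropic* `d`-dimensional Hausdorff measure, Mathlib's `μH[d]`, on the
  space–time `ℝ × T^d` with its product (sup) metric — equivalent to the Euclidean one up to
  constants, which does not affect `μH[d]`-null sets) on the flat torus `Ω = T^d` (any finite
  index type), with the accepted notions: pressure-explicit distributional Euler solutions
  `Torus.IsDistributionalNSSolutionOn T 0 0 u p` (`Literature.Analysis.FluidPDE.WeakSolution`),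
  the local energy balance `Torus.HasLocalEnergyBalance T 0 u p G D`
  (`Literature.Analysis.FluidPDE.DissipationAnomaly`; at `ν = 0` the weak-gradient slot `G` is
  irrelevant and is set to `0`) with `D = Torus.STFunctional.ofMeasure μ` for a (non-negative)
  measure `μ` on `ℝ × T^d` that is locally finite on the open slab (finite on
  `[δ, T-δ] × T^d` for every `δ > 0`) — this renders "`ε[u]` is a non-negative measure in
  `M_loc`, defined by the local energy balance (1.4)"; the accepted solution predicate moreover
  builds in `u ∈ L²((0,T) × T^d)`, `p ∈ L¹((0,T) × T^d)` up to the time endpoints, slightly more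
  than the printed `L^∞_loc(0,T; ·)` (harmless for energy-class limits, recorded in
  `scope_caveats`); the dimension is `d ≥ 2` as printed; boundedness of `u` and `p` is a joint
  essential bound on `(0,T) × T^d` (the printed `L^∞_loc L^∞_loc`; on the compact torus local
  and global coincide in `x`, and the bound is asked on every `[δ,T-δ]`). Conclusion: the
  restriction of `μ` to the open slab is absolutely continuous with respect to `μH[d]`.
* `DeRosaDrivasInversi2024_thm12_bounded.le_dimH_of_pos` — **proved** corollary (the printed
  second assertion): any space–time set charged by `ε[u]` inside the slab has Hausdorff
  dimension `≥ d` (Mathlib `dimH`), from absolute continuity and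
  `le_dimH_of_hausdorffMeasure_ne_zero`.
* The barrier docstring block sits on `DeRosaDrivasInversi2024_thm12_bounded`.
* `DeRosaDrivasInversi2024_thm19_bounded` (barrier audit 2026-08-15) — the *divergence-measure
  form* behind Thm. 1.2: op. cit. Thm. 1.9 (general conservation laws) in the bounded case
  `r = ∞`, with the bounded source term of App. B ((B.1)–(B.2), `l = m = ∞`), on the torus slab:
  if `e`, `Q`, `g` are bounded (jointly a.e.-strongly measurable, lifted convention) and
  `∂ₜe + div Q + μ = g` in `𝒟'((0,T) × T^d)` for a non-negative locally finite `μ`, then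
  `μ ≪ H^d` on the open slab. It needs neither the Euler equations nor `f = 0` nor strong
  compactness, so — unlike the unforced `…thm12_bounded`, which instantiates on no witness of the
  (necessarily forced) summit statement — it applies to finite windows of uniformly bounded
  *forced* Navier–Stokes families through weak-* limits of `(½|u_j|², (½|u_j|²+p_j)u_j, f·u_j)`.
  It carries a second barrier block. **Proved** from it: `….thm12_bounded` (it implies the Euler
  fact above), `….euler_forced` (the forced Euler case, App. B, with the forced local energy
  balance written out since `Torus.HasLocalEnergyBalance` has no force slot) and
  `….le_dimH_of_pos` (dimension `≥ d` of charged sets).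

## References

* L. De Rosa, T. D. Drivas, M. Inversi, J. Math. Fluid Mech. 26 (2024); arXiv:2301.09603:
  Abstract, §1 with (1.4) and Def. 1.1, Thm. 1.2, Rem. 1.3 and the discussion following it
  (sharpness; Meneveau–Sreenivasan `2.87`), §1.2 (Ex. 1.5–1.7, Thm. 1.9), Thm. 1.10, §2
  (Lemma 2.3, Cor. 2.4, Thm. 2.6, Rem. 2.7), §3 (Thm. 3.1, Prop. 3.2), App. A (Prop. A.1),
  App. B (external forces), §5.
* L. De Rosa, P. Isett, Arch. Ration. Mech. Anal. 248 (2024) (upper bounds: intermittency from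
  lower-dimensional dissipation; `IntermittentDissipation.lean`).
* J. Duchon, R. Robert, Nonlinearity 13 (2000) (the local energy balance / dissipation measure).
-/

open MeasureTheory Set Filter Topology
open scoped ENNReal NNReal

noncomputable section

namespace Literature.Barriers.AnomalousDissipation

/-- **De Rosa–Drivas–Inversi: dissipation of bounded Euler flows is absolutely continuous with
respect to `d`-dimensional space–time Hausdorff measure** (JMFM 26 (2024), Thm. 1.2 of
arXiv:2301.09603, case `r = q = ∞`, `Ω = T^d`). Let `d ≥ 2`, `T > 0` and let `(u, p)` be a
distributional solution of the incompressible Euler equations on `T^d × (0,T)` (pressure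
explicit, unforced; the accepted predicate also carries `u ∈ L²` and `p ∈ L¹` on the whole of
`(0,T) × T^d`, slightly more than the printed local integrability)
with `u` and `p` essentially bounded on `[δ, T-δ] × T^d` for every `δ > 0`. Suppose the local
energy balance `∂ₜ(½|u|²) + div((½|u|² + p)u) = -ε[u]` holds in `𝒟'((0,T) × T^d)` with `ε[u]`
given by a non-negative measure `μ` on `ℝ × T^d`, finite on every `[δ, T-δ] × T^d`
(`ε[u] ∈ M_loc`, op. cit. (1.4)). Then `ε[u] ≪ H^d`: the restriction of `μ` to the open slab
`(0,T) × T^d` is absolutely continuous with respect to the `d`-dimensional Hausdorff measure of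
the space–time `ℝ × T^d` (`d + 1` dimensions in all). In particular, if `ε[u]` is non-trivial
and concentrated on a space–time set `S` then `dim_H S ≥ d` (proved below as
`.le_dimH_of_pos`).

BARRIER (D-0021):
- technique_class: extreme-intermittency-scenarios dissipation-on-sets-of-dimension-below-space bounded-vanishing-viscosity-limits lagrangian-trajectory-or-pointlike-dissipation
- blocks: scenarios and witness constructions for `Literature.Turb.ZerothLaw` = `AnomalousDissipation` (read on a finite window through a limiting dissipation measure, cf. `Torus.IsDissipationMeasureOf` / `Torus.HasAnomalousDissipationMeasure`) in which the velocities (and pressures) stay bounded while the anomalous dissipation concentrates on a space–time set of Hausdorff dimension `< d` — e.g. on finitely many Lagrangian trajectories, points, or `{instants} × {curves}` in `d = 3`: for bounded weak Euler limits `ε[u] ≪ H^d`, so such sets carry no dissipation [cite: DeRosaDrivasInversi2024, Thm. 1.2 and Abstract]; for `u ∈ L^q_t L^r_x` the admissible dimension is `s = d(r-2)/r - 2(r+d)/((q-1)r)` for the anisotropic `H^s_α` [cite: DeRosaDrivasInversi2024, Thm. 1.2]; consequently, for bounded families the dimension bound `γ` (space–time Minkowski dimension `≤ γ + 1` of the support)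 entering the companion upper-bound barrier `DeRosaIsett2024_thm213` cannot be taken below `d - 1`, since the Minkowski dimension of the support dominates the Hausdorff dimension of any concentration set [cite: DeRosaIsett2024, Thm. 2.13 and Def. 2.5] [cite: DeRosaDrivasInversi2024, §1 ("a precise, rigorous connection … [Is17, DRI22]")].
- because: the local energy balance exhibits `ε[u]` as the space–time divergence of the `L^∞` (resp. `L^{q/3}_t L^{r/3}_x`) field `(½|u|², (½|u|² + p)u)`; testing against cut-offs of space–time cylinders `C^α_δ(x,t)` gives `ε[u](C_δ) ≲ δ^s` uniformly, and a Frostman-type covering lemma turns this cylinder asymptotic into `ε[u] ≪ H^s_α` and the dimension bound for concentration sets [cite: DeRosaDrivasInversi2024, §2, Lemma 2.3, Cor. 2.4 and Thm. 2.6].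
- evasions_known: dissipation on sets of dimension exactly `d` is possible and realised: the forced constructions dissipate everything at the single instant `T` (the set `{T} × T³`, dimension `3 = d`) [cite: DeRosaDrivasInversi2024, Abstract and §1] [cite: BrueDeLellis2023, Thm. 1.1] [cite: BCCDS2024, Thm. 1.1], and codimension-one shocks saturate the compressible analogue [cite: DeRosaDrivasInversi2024, Abstract]; unbounded velocities (`r < ∞` or `q < ∞`) lower the admissible dimension to `s < d` [cite: DeRosaDrivasInversi2024, Thm. 1.2 and Rem. 1.3]; experimentally the spatial support dimension `≈ 2.87` (space–time `≈ 3.87`) sits `0.87` above the bound [cite: DeRosaDrivasInversi2024, §1].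
- scope_caveats: printed for weak Euler solutions with the stated integrability on a general domain, interior dissipation on `Ω × (0,T)` (boundary/terminal-time dissipation needs the "boundary extendable" variant, op. cit. Def. 1.1 and §5) [cite: DeRosaDrivasInversi2024, Thm. 1.2]; vendored only in the bounded case `r = q = ∞` on `T^d` with the isotropic Hausdorff measure (the general `H^s_α` is not in Mathlib), with the pressure assumed bounded as the theorem requires at `r = ∞` [cite: DeRosaDrivasInversi2024, Rem. 1.3], and with the extra global integrability `u ∈ L²((0,T) × T^d)`, `p ∈ L¹((0,T) × T^d)` inherited from the accepted predicate `Torus.IsDistributionalNSSolutionOn` (the printed hypotheses are only local in `(0,T)`, so the vendored fact covers slightly fewer pairs `(u,p)`); it is a statement about a *given* weak Euler limit — it says nothing about long-time averages, forcing, or whether bounded vanishing-viscosity limits with anomalous dissipation exist; the lower bound is on the Hausdorff dimension of concentration sets, whereas the companion upper-bound barrier uses Minkowski-type dimensions of the support [cite: DeRosaIsett2024, Def. 2.5]; (audit 2026-08-15) this decl is *unforced* (`f = 0`) and is phrased through the limit's own balance `ε[u] = μ` (which identifies a limiting dissipation measure only under strong `L³` compactness, op. cit. Prop. A.1), whereas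 every witness of the summit statement is forced (`f ≠ 0`, since for `f = 0` the energy inequality gives `⟨ν‖∇u‖²⟩ = 0`) — so it never instantiates verbatim on a witness window; the printed theorem does cover forcing [cite: DeRosaDrivasInversi2024, App. B] and, in its divergence-measure form, compactness-free weak-* limits of bounded families [cite: DeRosaDrivasInversi2024, Thm. 1.9 and Thm. 2.6]: that form is vendored below as `DeRosaDrivasInversi2024_thm19_bounded`, from which this decl is derived (`DeRosaDrivasInversi2024_thm19_bounded.thm12_bounded`).
- status: established (theorem) [cite: DeRosaDrivasInversi2024, Thm. 1.2] -/
def DeRosaDrivasInversi2024_thm12_bounded : Prop :=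
  ∀ (d : Type) [Fintype d] [DecidableEq d] (_hd : 2 ≤ Fintype.card d) (T : ℝ) (_hT : 0 < T)
    (u : ℝ → UnitAddTorus d → EuclideanSpace ℝ d) (p : ℝ → UnitAddTorus d → ℝ)
    (_hsol : Literature.Analysis.FluidPDE.Torus.IsDistributionalNSSolutionOn T 0 0 u p)
    (_hu : ∀ δ : ℝ, 0 < δ → ∃ M : ℝ,
      ∀ᵐ z ∂(volume.restrict (Icc δ (T - δ) ×ˢ univ)), ‖u z.1 z.2‖ ≤ M)
    (_hp : ∀ δ : ℝ, 0 < δ → ∃ M : ℝ,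
      ∀ᵐ z ∂(volume.restrict (Icc δ (T - δ) ×ˢ univ)), |p z.1 z.2| ≤ M)
    (μ : Measure (ℝ × UnitAddTorus d)) (_hμ : ∀ δ : ℝ, 0 < δ → μ (Icc δ (T - δ) ×ˢ univ) < ∞)
    (_hbal : Literature.Analysis.FluidPDE.Torus.HasLocalEnergyBalance T 0 u p 0 (Literature.Analysis.FluidPDE.Torus.STFunctional.ofMeasure μ)),
    μ.restrict (Ioo 0 T ×ˢ univ) ≪ μH[Fintype.card d]

/-- **Corollary (the printed dimension bound): concentration sets of the dissipation have
Hausdorff dimension at least `d`.** Under `DeRosaDrivasInversi2024_thm12_bounded`, in the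
situation of that fact, every space–time set `S` charged by the dissipation inside the slab,
`μ(S ∩ ((0,T) × T^d)) > 0`, has `dim_H S ≥ d` — "if `ε[u]` is non-trivial and concentrated
on a space–time set `S`, we have `dim S ≥ s`" with `s = d` (De Rosa–Drivas–Inversi 2024,
Thm. 1.2, second assertion; Cor. 2.4). Proved from the named fact via Mathlib's
`le_dimH_of_hausdorffMeasure_ne_zero`. [cite: DeRosaDrivasInversi2024, Thm. 1.2] -/
theorem DeRosaDrivasInversi2024_thm12_bounded.le_dimH_of_pos
    (h : DeRosaDrivasInversi2024_thm12_bounded)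
    (d : Type) [Fintype d] [DecidableEq d] (hd : 2 ≤ Fintype.card d) (T : ℝ) (hT : 0 < T)
    (u : ℝ → UnitAddTorus d → EuclideanSpace ℝ d) (p : ℝ → UnitAddTorus d → ℝ)
    (hsol : Literature.Analysis.FluidPDE.Torus.IsDistributionalNSSolutionOn T 0 0 u p)
    (hu : ∀ δ : ℝ, 0 < δ → ∃ M : ℝ,
      ∀ᵐ z ∂(volume.restrict (Icc δ (T - δ) ×ˢ univ)), ‖u z.1 z.2‖ ≤ M)
    (hp : ∀ δ : ℝ, 0 < δ → ∃ M : ℝ,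
      ∀ᵐ z ∂(volume.restrict (Icc δ (T - δ) ×ˢ univ)), |p z.1 z.2| ≤ M)
    (μ : Measure (ℝ × UnitAddTorus d)) (hμ : ∀ δ : ℝ, 0 < δ → μ (Icc δ (T - δ) ×ˢ univ) < ∞)
    (hbal : Literature.Analysis.FluidPDE.Torus.HasLocalEnergyBalance T 0 u p 0 (Literature.Analysis.FluidPDE.Torus.STFunctional.ofMeasure μ))
    (S : Set (ℝ × UnitAddTorus d)) (hS : 0 < μ (S ∩ (Ioo 0 T ×ˢ univ))) :
    (Fintype.card d : ℝ≥0∞) ≤ dimH S := by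
  have hac := h d hd T hT u p hsol hu hp μ hμ hbal
  -- the slab restriction of `μ` charges `S`, hence so does `μH[d]`
  have hpos : μ.restrict (Ioo 0 T ×ˢ univ) S ≠ 0 := by
    rw [Measure.restrict_apply' (measurableSet_Ioo.prod MeasurableSet.univ)]
    exact hS.ne'
  have hH : μH[(Fintype.card d : ℝ)] S ≠ 0 := fun h0 => hpos (hac h0)
  have := le_dimH_of_hausdorffMeasure_ne_zero (d := (Fintype.card d : ℝ≥0)) (by simpa using hH)
  simpa using this


/-! ### The divergence-measure form (Thm. 1.9, `r = ∞`, with the source term of App. B)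

Added by the 2026-08-15 barrier audit: the unforced Euler fact above never meets a witness of the
(forced) summit statement; the statement below is the printed engine that does, and the Euler
fact is re-derived from it. -/

open scoped RealInnerProductSpace

/-- **De Rosa–Drivas–Inversi: a non-negative measure that is the space–time divergence of a
bounded field (plus a bounded source) charges no `H^d`-null set** (J. Math. Fluid Mech. 26
(2024); arXiv:2301.09603, Thm. 1.9 — general conservation laws — in the bounded case `r = ∞`
("for `r = ∞` we have `D ≪ H^d`"), with the bounded source term of App. B ((B.1)–(B.2) with
`l = m = ∞`); the measure-theoretic engine behind Thm. 1.2, cf. Thm. 2.6 (Šilhavý) and Rem. 2.7;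
`Ω = T^d`, the argument being local). Let `d ≥ 1`, `T ∈ ℝ`, and let `e` (energy/entropy density),
`Q` (flux) and `g` (source) be fields on `ℝ × T^d`, jointly a.e.-strongly measurable on
`(0,T) × T^d` (lifted convention `Torus.stLift`, as in `Torus.IsDistributionalNSSolutionOn`) and
essentially bounded on `[δ, T-δ] × T^d` for every `δ > 0`. Let `μ` be a (non-negative) measure
on `ℝ × T^d`, finite on every `[δ, T-δ] × T^d`, such that `∂ₜ e + div Q + μ = g` in
`𝒟'((0,T) × T^d)`, i.e. `∫₀ᵀ∫ (e ∂ₜψ + Q·∇ψ + g ψ) dx dt = ∫ ψ dμ` for every smooth `ψ`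
compactly supported in time in `(0,T)` (the entropy balance `div_{t,x}(η, Q) = -D` of op. cit.
Def. 1.4, (1.9), with a source). Then `μ ≪ H^d` on the open slab `(0,T) × T^d` (isotropic
`d`-dimensional Hausdorff measure of the `(d+1)`-dimensional space–time, Mathlib's `μH[d]` for
the sup metric). Specialisations, all **proved** below: the unforced Euler fact
`DeRosaDrivasInversi2024_thm12_bounded` (`e = ½|u|²`, `Q = (½|u|² + p)u`, `g = 0`;
`.thm12_bounded`), the forced Euler case (`g = f·u`, op. cit. App. B; `.euler_forced`) and the
dimension bound for charged sets (`.le_dimH_of_pos`). It applies equally to weak-* limits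
`(e, Q, g)` of `(½|u_j|², (½|u_j|² + p_j)u_j, f·u_j)` along uniformly bounded forced
Navier–Stokes families with `μ = lim ν_j|∇u_j|²` (op. cit. Ex. 1.5–1.6, (1.11)), no strong
compactness being needed.

BARRIER (D-0021):
- technique_class: bounded-vanishing-viscosity-limits forced-bounded-families weak-star-limits-without-compactness dissipation-on-sets-of-dimension-below-space lagrangian-trajectory-or-pointlike-dissipation extreme-intermittency-scenarios
- blocks: witness families for `Literature.Turb.ZerothLaw` = `AnomalousDissipation` (steady smooth force `f`, Leray–Hopf `u_j`, `ν_j → 0`) read on a finite window through a limiting dissipation measure `D = lim ν_j|∇u_j|²` (cf. `Torus.IsDissipationMeasureOf` / `Torus.HasAnomalousDissipationMeasure`) in which the velocities `u_j` *and* the pressures `p_j` stay bounded in `L^∞` uniformly in `j` while `D` gives positive mass to a space–time set of Hausdorff dimension `< d` — e.g. dissipation carried by finitely many points, Lagrangian trajectories or `{instants} × {curves}` in `d = 3`: bounded Leray–Hopf solutions lie in `L⁴_{t,x}`, where the local energy equality holds (no Duchon–Robert defect), so `ν_j|∇u_j|² = -∂ₜ½|u_j|² - div((½|u_j|² + p_j)u_j)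 + ν_jΔ½|u_j|² + f·u_j`, and every weak-* limit point yields `∂ₜe + div Q + D = g` with `e, Q, g ∈ L^∞`, whence `D ≪ H^d` on the open window, forcing and lack of strong convergence notwithstanding [cite: DeRosaDrivasInversi2024, Thm. 1.9, Ex. 1.5–1.6, (1.11) and App. B]; for strongly convergent families this is the printed Euler statement [cite: DeRosaDrivasInversi2024, Thm. 1.2 and Prop. A.1].
- because: `μ(C_δ(x,t)) ≤ ∫ χ_δ dμ = ∫ (e ∂ₜχ_δ + Q·∇χ_δ + g χ_δ) ≲ (‖e‖_∞ + ‖Q‖_∞) δ^d + ‖g‖_∞ δ^{d+1}` uniformly on compact sub-slabs, and a measure with this cylinder asymptotic is absolutely continuous with respect to `H^d` (Lemma 2.3, the easy half of Frostman's lemma), so its concentration sets have `dim_H ≥ d` (Cor. 2.4) [cite: DeRosaDrivasInversi2024, §2: Lemma 2.3, Cor. 2.4, Thm. 2.6, Rem. 2.7; §3 Prop. 3.2; App. B (B.1)–(B.2)].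
- evasions_known: those of `DeRosaDrivasInversi2024_thm12_bounded` — dimension exactly `d` is attained (`{T} × T³` in the forced constructions [cite: BrueDeLellis2023, Thm. 1.1] [cite: BCCDS2024, Thm. 1.1]; codimension-one shocks in the compressible analogue [cite: DeRosaDrivasInversi2024, Thm. 1.9 ff.]); unbounded families escape quantitatively: for `u ∈ L^q_t L^r_x` only `H^s_α`-null sets with `s = d(r-2)/r - 2(r+d)/((q-1)r) < d`, `α = q(r+d)/((q-1)r)` are uncharged [cite: DeRosaDrivasInversi2024, Thm. 1.2 and Rem. 3.3], so in `d = 3` a finite-energy velocity growing like `dist^{-1/3}` towards a curve (`u ∈ L^∞_t L^r_x` only for `r < 6`, `s(6) = 2`) is compatible with dissipation on that curve × time, and `dist^{-2/3}` towards a point (`r < 9/2`, `s = α = 5/3`) with dissipation on a point × time; bounded velocity with unbounded (`BMO`) pressure keeps the dimension bound `d` but loses absolute continuity [cite: DeRosaDrivasInversi2024, Rem. 1.3]; Leray–Hopf families that are not locally energy-balanced (a signed defect `D[u_j]`, not excluded for unbounded non-suitable solutions) are constrained only through the total defect [cite: DeRosaDrivasInversi2024, (1.11)].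
- scope_caveats: printed as Thm. 1.9 for entropy pairs `η[u], Q[u] ∈ L^∞_loc` of general systems of conservation laws on `Ω × (0,T)`, `Ω ⊆ ℝ^d` a domain, `d ≥ 1`, `D ≥ 0` in `M_loc`, source-free; the source `g` is the App. B modification ("details are sketched", (B.1)–(B.2) with `l = m = ∞`) and `T^d` replaces `Ω` (local argument) [cite: DeRosaDrivasInversi2024, Thm. 1.9 and App. B]; interior statement only — dissipation at `t = 0`, `t = T` or at a physical boundary needs the boundary-extendable variant [cite: DeRosaDrivasInversi2024, Def. 1.1 and Prop. A.1]; measurability is asked in the lifted convention and boundedness as a joint essential bound on each `[δ,T-δ] × T^d` (the printed `L^∞_loc`); it constrains a *given* window of a *given* bounded family and says nothing about long-time averages or about whether bounded dissipating families exist under steady forcing [cite: DeRosaDrivasInversi2024, §1].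
- status: established (theorem) [cite: DeRosaDrivasInversi2024, Thm. 1.9] -/
def DeRosaDrivasInversi2024_thm19_bounded : Prop :=
  ∀ (d : Type) [Fintype d] [DecidableEq d] (_hd : 1 ≤ Fintype.card d) (T : ℝ)
    (e : ℝ → UnitAddTorus d → ℝ) (Q : ℝ → UnitAddTorus d → EuclideanSpace ℝ d)
    (g : ℝ → UnitAddTorus d → ℝ)
    (_he_meas : AEStronglyMeasurable (Literature.Analysis.FunctionSpaces.Torus.stLift e)
      (volume.restrict (Ioo 0 T ×ˢ univ)))
    (_hQ_meas : AEStronglyMeasurable (Literature.Analysis.FunctionSpaces.Torus.stLift Q)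
      (volume.restrict (Ioo 0 T ×ˢ univ)))
    (_hg_meas : AEStronglyMeasurable (Literature.Analysis.FunctionSpaces.Torus.stLift g)
      (volume.restrict (Ioo 0 T ×ˢ univ)))
    (_he : ∀ δ : ℝ, 0 < δ → ∃ M : ℝ,
      ∀ᵐ z ∂(volume.restrict (Icc δ (T - δ) ×ˢ univ)), |e z.1 z.2| ≤ M)
    (_hQ : ∀ δ : ℝ, 0 < δ → ∃ M : ℝ,
      ∀ᵐ z ∂(volume.restrict (Icc δ (T - δ) ×ˢ univ)), ‖Q z.1 z.2‖ ≤ M)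
    (_hg : ∀ δ : ℝ, 0 < δ → ∃ M : ℝ,
      ∀ᵐ z ∂(volume.restrict (Icc δ (T - δ) ×ˢ univ)), |g z.1 z.2| ≤ M)
    (μ : Measure (ℝ × UnitAddTorus d)) (_hμ : ∀ δ : ℝ, 0 < δ → μ (Icc δ (T - δ) ×ˢ univ) < ∞)
    (_hbal : ∀ ψ : ℝ → UnitAddTorus d → ℝ,
      Literature.Analysis.FunctionSpaces.Torus.IsSpaceTimeTestIoo T ψ →
        ∫ t in Ioo 0 T, ∫ x,
          (e t x * Literature.Analysis.FunctionSpaces.Torus.timeDeriv ψ t x +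
            ⟪Q t x, Literature.Analysis.FunctionSpaces.Torus.gradient (ψ t) x⟫ +
            g t x * ψ t x) = ∫ z, ψ z.1 z.2 ∂μ),
    μ.restrict (Ioo 0 T ×ˢ univ) ≪ μH[Fintype.card d]

/-- **Corollary (dimension bound, divergence-measure form): sets charged by `μ` inside the slab
have Hausdorff dimension at least `d`.** Under `DeRosaDrivasInversi2024_thm19_bounded`, in its
situation, `μ(S ∩ ((0,T) × T^d)) > 0` implies `dim_H S ≥ d` ("if `D` is non-trivial and
concentrated on a space-time set `S`, we have `dim_H S ≥ s`" with `s = d`; De Rosa–Drivas–Inversi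
2024, Thm. 1.9 and Cor. 2.4). Proved via Mathlib's `le_dimH_of_hausdorffMeasure_ne_zero`. [cite: DeRosaDrivasInversi2024, Thm. 1.9] -/
theorem DeRosaDrivasInversi2024_thm19_bounded.le_dimH_of_pos
    (h : DeRosaDrivasInversi2024_thm19_bounded)
    (d : Type) [Fintype d] [DecidableEq d] (hd : 1 ≤ Fintype.card d) (T : ℝ)
    (e : ℝ → UnitAddTorus d → ℝ) (Q : ℝ → UnitAddTorus d → EuclideanSpace ℝ d)
    (g : ℝ → UnitAddTorus d → ℝ)
    (he_meas : AEStronglyMeasurable (Literature.Analysis.FunctionSpaces.Torus.stLift e)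
      (volume.restrict (Ioo 0 T ×ˢ univ)))
    (hQ_meas : AEStronglyMeasurable (Literature.Analysis.FunctionSpaces.Torus.stLift Q)
      (volume.restrict (Ioo 0 T ×ˢ univ)))
    (hg_meas : AEStronglyMeasurable (Literature.Analysis.FunctionSpaces.Torus.stLift g)
      (volume.restrict (Ioo 0 T ×ˢ univ)))
    (he : ∀ δ : ℝ, 0 < δ → ∃ M : ℝ,
      ∀ᵐ z ∂(volume.restrict (Icc δ (T - δ) ×ˢ univ)), |e z.1 z.2| ≤ M)
    (hQ : ∀ δ : ℝ, 0 < δ → ∃ M : ℝ,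
      ∀ᵐ z ∂(volume.restrict (Icc δ (T - δ) ×ˢ univ)), ‖Q z.1 z.2‖ ≤ M)
    (hg : ∀ δ : ℝ, 0 < δ → ∃ M : ℝ,
      ∀ᵐ z ∂(volume.restrict (Icc δ (T - δ) ×ˢ univ)), |g z.1 z.2| ≤ M)
    (μ : Measure (ℝ × UnitAddTorus d)) (hμ : ∀ δ : ℝ, 0 < δ → μ (Icc δ (T - δ) ×ˢ univ) < ∞)
    (hbal : ∀ ψ : ℝ → UnitAddTorus d → ℝ,
      Literature.Analysis.FunctionSpaces.Torus.IsSpaceTimeTestIoo T ψ →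
        ∫ t in Ioo 0 T, ∫ x,
          (e t x * Literature.Analysis.FunctionSpaces.Torus.timeDeriv ψ t x +
            ⟪Q t x, Literature.Analysis.FunctionSpaces.Torus.gradient (ψ t) x⟫ +
            g t x * ψ t x) = ∫ z, ψ z.1 z.2 ∂μ)
    (S : Set (ℝ × UnitAddTorus d)) (hS : 0 < μ (S ∩ (Ioo 0 T ×ˢ univ))) :
    (Fintype.card d : ℝ≥0∞) ≤ dimH S := by
  have hac := h d hd T e Q g he_meas hQ_meas hg_meas he hQ hg μ hμ hbal
  have hpos : μ.restrict (Ioo 0 T ×ˢ univ) S ≠ 0 := by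
    rw [Measure.restrict_apply' (measurableSet_Ioo.prod MeasurableSet.univ)]
    exact hS.ne'
  have hH : μH[(Fintype.card d : ℝ)] S ≠ 0 := fun h0 => hpos (hac h0)
  have := le_dimH_of_hausdorffMeasure_ne_zero (d := (Fintype.card d : ℝ≥0)) (by simpa using hH)
  simpa using this

/-- **The divergence-measure form implies the Euler fact.** `DeRosaDrivasInversi2024_thm19_bounded`
implies `DeRosaDrivasInversi2024_thm12_bounded`: take `e = ½|u|²`, `Q = (½|u|² + p)u`, `g = 0`
(op. cit. Ex. 1.5: `V = (½|u|², (½|u|² + p)u)`); joint measurability and the essential bounds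
of `e`, `Q` follow from those of `u`, `p`, and the local energy balance
`Torus.HasLocalEnergyBalance T 0 u p 0 (ofMeasure μ)` is the required identity term by term
(`⟪(½|u|² + p)u, ∇ψ⟫ = (½|u|² + p)⟪u, ∇ψ⟫`; the viscous terms vanish at `ν = 0`). This is how
Thm. 1.2 (`r = q = ∞`) follows from the general conservation-law statement (De Rosa–Drivas–Inversi
2024, §1.2 and Rem. 2.7). [cite: DeRosaDrivasInversi2024, Thm. 1.2 and Ex. 1.5] -/
theorem DeRosaDrivasInversi2024_thm19_bounded.thm12_bounded
    (h : DeRosaDrivasInversi2024_thm19_bounded) : DeRosaDrivasInversi2024_thm12_bounded := by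
  intro d _ _ hd T hT u p hsol hu hp μ hμ hbal
  -- the entropy pair `(½|u|², (½|u|² + p)u)` and zero source
  set e : ℝ → UnitAddTorus d → ℝ := fun t x => 2⁻¹ * ‖u t x‖ ^ 2 with he_def
  set Q : ℝ → UnitAddTorus d → EuclideanSpace ℝ d :=
    fun t x => (2⁻¹ * ‖u t x‖ ^ 2 + p t x) • u t x with hQ_def
  set g : ℝ → UnitAddTorus d → ℝ := fun _ _ => 0 with hg_def
  have hu_meas := hsol.1
  have hp_meas := hsol.2.2.1
  have he_meas : AEStronglyMeasurable (Literature.Analysis.FunctionSpaces.Torus.stLift e)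
      (volume.restrict (Ioo 0 T ×ˢ univ)) := by
    have : Literature.Analysis.FunctionSpaces.Torus.stLift e =
        fun q => 2⁻¹ * ‖Literature.Analysis.FunctionSpaces.Torus.stLift u q‖ ^ 2 := rfl
    rw [this]
    exact (hu_meas.norm.pow 2).const_mul _
  have hQ_meas : AEStronglyMeasurable (Literature.Analysis.FunctionSpaces.Torus.stLift Q)
      (volume.restrict (Ioo 0 T ×ˢ univ)) := by
    have : Literature.Analysis.FunctionSpaces.Torus.stLift Q =
        fun q => (2⁻¹ * ‖Literature.Analysis.FunctionSpaces.Torus.stLift u q‖ ^ 2 +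
          Literature.Analysis.FunctionSpaces.Torus.stLift p q) •
          Literature.Analysis.FunctionSpaces.Torus.stLift u q := rfl
    rw [this]
    exact (((hu_meas.norm.pow 2).const_mul _).add hp_meas).smul hu_meas
  have hg_meas : AEStronglyMeasurable (Literature.Analysis.FunctionSpaces.Torus.stLift g)
      (volume.restrict (Ioo 0 T ×ˢ univ)) := by
    have : Literature.Analysis.FunctionSpaces.Torus.stLift g = fun _ => 0 := rfl
    rw [this]
    exact aestronglyMeasurable_const
  have he : ∀ δ : ℝ, 0 < δ → ∃ M : ℝ,
      ∀ᵐ z ∂(volume.restrict (Icc δ (T - δ) ×ˢ univ)), |e z.1 z.2| ≤ M := by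
    intro δ hδ
    obtain ⟨M, hM⟩ := hu δ hδ
    refine ⟨2⁻¹ * M ^ 2, hM.mono fun z hz => ?_⟩
    have h0 : 0 ≤ ‖u z.1 z.2‖ := norm_nonneg _
    have h1 : ‖u z.1 z.2‖ ^ 2 ≤ M ^ 2 := pow_le_pow_left₀ h0 hz 2
    rw [he_def, abs_of_nonneg (by positivity)]
    linarith
  have hQ : ∀ δ : ℝ, 0 < δ → ∃ M : ℝ,
      ∀ᵐ z ∂(volume.restrict (Icc δ (T - δ) ×ˢ univ)), ‖Q z.1 z.2‖ ≤ M := by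
    intro δ hδ
    obtain ⟨M, hM⟩ := hu δ hδ
    obtain ⟨M', hM'⟩ := hp δ hδ
    refine ⟨(2⁻¹ * M ^ 2 + M') * M, (hM.and hM').mono fun z hz => ?_⟩
    obtain ⟨hzu, hzp⟩ := hz
    have h0 : 0 ≤ ‖u z.1 z.2‖ := norm_nonneg _
    have hM0 : 0 ≤ M := h0.trans hzu
    have hM'0 : 0 ≤ M' := (abs_nonneg _).trans hzp
    have h1 : ‖u z.1 z.2‖ ^ 2 ≤ M ^ 2 := pow_le_pow_left₀ h0 hzu 2
    have h2 : |2⁻¹ * ‖u z.1 z.2‖ ^ 2 + p z.1 z.2| ≤ 2⁻¹ * M ^ 2 + M' := by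
      calc |2⁻¹ * ‖u z.1 z.2‖ ^ 2 + p z.1 z.2|
          ≤ |2⁻¹ * ‖u z.1 z.2‖ ^ 2| + |p z.1 z.2| := abs_add_le _ _
        _ ≤ 2⁻¹ * M ^ 2 + M' := by
          rw [abs_of_nonneg (by positivity)]
          exact add_le_add (by linarith) hzp
    rw [hQ_def, norm_smul, Real.norm_eq_abs]
    exact mul_le_mul h2 hzu h0 (by positivity)
  have hg : ∀ δ : ℝ, 0 < δ → ∃ M : ℝ,
      ∀ᵐ z ∂(volume.restrict (Icc δ (T - δ) ×ˢ univ)), |g z.1 z.2| ≤ M :=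
    fun δ _ => ⟨0, Eventually.of_forall fun z => by simp [hg_def]⟩
  refine h d (le_trans (by norm_num) hd) T e Q g he_meas hQ_meas hg_meas he hQ hg μ hμ ?_
  intro ψ hψ
  have hb := hbal.2 ψ hψ
  have hfun : (fun t => ∫ x, (e t x * Literature.Analysis.FunctionSpaces.Torus.timeDeriv ψ t x +
        ⟪Q t x, Literature.Analysis.FunctionSpaces.Torus.gradient (ψ t) x⟫ + g t x * ψ t x)) =
      fun t => ∫ x, (2⁻¹ * ‖u t x‖ ^ 2 * Literature.Analysis.FunctionSpaces.Torus.timeDeriv ψ t x +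
        (2⁻¹ * ‖u t x‖ ^ 2 + p t x) *
          ⟪u t x, Literature.Analysis.FunctionSpaces.Torus.gradient (ψ t) x⟫ +
        2⁻¹ * (0 : ℝ) * ‖u t x‖ ^ 2 * Literature.Analysis.FunctionSpaces.Torus.laplacian (ψ t) x -
        (0 : ℝ) * Literature.Analysis.FluidPDE.Torus.weakGradNormSq
          ((0 : ℝ → UnitAddTorus d → EuclideanSpace ℝ d →L[ℝ] EuclideanSpace ℝ d) t) x * ψ t x) := by
    funext t
    congr 1
    funext x
    simp only [he_def, hQ_def, hg_def, real_inner_smul_left, zero_mul, mul_zero, add_zero, sub_zero]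
  rw [hfun]
  exact hb


/-- **Forced bounded Euler flows: `ε[u] ≪ H^d`** (De Rosa–Drivas–Inversi 2024, App. B with
Thm. 1.2, `r = q = ∞`: "if a force `f` appears on the right hand side of the momentum equations
… the additional term `f·u` appears in the corresponding local energy balance", and for bounded
`f·u` — (B.1)–(B.2) with `l = m = ∞` — "the same conclusions follow"). Let `(u, p)` be a
distributional solution of the Euler equations on `T^d × (0,T)` forced by `f`
(`Torus.IsDistributionalNSSolutionOn T 0 f u p`), with `f` jointly a.e.-strongly measurable
(lifted convention) and `f`, `u`, `p` essentially bounded on every `[δ, T-δ] × T^d`, and let the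
forced local energy balance `∂ₜ(½|u|²) + div((½|u|² + p)u) + ε[u] = f·u` hold in
`𝒟'((0,T) × T^d)` with `ε[u]` given by a measure `μ`, finite on every `[δ, T-δ] × T^d` — written
out as `∫₀ᵀ∫ [½|u|² ∂ₜψ + (½|u|² + p) ⟪u, ∇ψ⟫ + ⟪f, u⟫ ψ] = ∫ ψ dμ` for all smooth `ψ`
compactly supported in time in `(0,T)` (the accepted `Torus.HasLocalEnergyBalance` has no force
slot). Then `μ ≪ H^d` on the open slab. Proved from `DeRosaDrivasInversi2024_thm19_bounded` with
`e = ½|u|²`, `Q = (½|u|² + p)u`, `g = ⟪f, u⟫`. This is the form that meets windows of (strongly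
convergent) witness families of the forced summit statement. [cite: DeRosaDrivasInversi2024, App. B] -/
theorem DeRosaDrivasInversi2024_thm19_bounded.euler_forced
    (h : DeRosaDrivasInversi2024_thm19_bounded)
    (d : Type) [Fintype d] [DecidableEq d] (hd : 2 ≤ Fintype.card d) (T : ℝ)
    (f u : ℝ → UnitAddTorus d → EuclideanSpace ℝ d) (p : ℝ → UnitAddTorus d → ℝ)
    (hsol : Literature.Analysis.FluidPDE.Torus.IsDistributionalNSSolutionOn T 0 f u p)
    (hf_meas : AEStronglyMeasurable (Literature.Analysis.FunctionSpaces.Torus.stLift f)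
      (volume.restrict (Ioo 0 T ×ˢ univ)))
    (hf : ∀ δ : ℝ, 0 < δ → ∃ M : ℝ,
      ∀ᵐ z ∂(volume.restrict (Icc δ (T - δ) ×ˢ univ)), ‖f z.1 z.2‖ ≤ M)
    (hu : ∀ δ : ℝ, 0 < δ → ∃ M : ℝ,
      ∀ᵐ z ∂(volume.restrict (Icc δ (T - δ) ×ˢ univ)), ‖u z.1 z.2‖ ≤ M)
    (hp : ∀ δ : ℝ, 0 < δ → ∃ M : ℝ,
      ∀ᵐ z ∂(volume.restrict (Icc δ (T - δ) ×ˢ univ)), |p z.1 z.2| ≤ M)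
    (μ : Measure (ℝ × UnitAddTorus d)) (hμ : ∀ δ : ℝ, 0 < δ → μ (Icc δ (T - δ) ×ˢ univ) < ∞)
    (hbal : ∀ ψ : ℝ → UnitAddTorus d → ℝ,
      Literature.Analysis.FunctionSpaces.Torus.IsSpaceTimeTestIoo T ψ →
        ∫ t in Ioo 0 T, ∫ x,
          (2⁻¹ * ‖u t x‖ ^ 2 * Literature.Analysis.FunctionSpaces.Torus.timeDeriv ψ t x +
            (2⁻¹ * ‖u t x‖ ^ 2 + p t x) *
              ⟪u t x, Literature.Analysis.FunctionSpaces.Torus.gradient (ψ t) x⟫ +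
            ⟪f t x, u t x⟫ * ψ t x) = ∫ z, ψ z.1 z.2 ∂μ) :
    μ.restrict (Ioo 0 T ×ˢ univ) ≪ μH[Fintype.card d] := by
  -- the entropy pair `(½|u|², (½|u|² + p)u)` and the work `f·u` as source
  set e : ℝ → UnitAddTorus d → ℝ := fun t x => 2⁻¹ * ‖u t x‖ ^ 2 with he_def
  set Q : ℝ → UnitAddTorus d → EuclideanSpace ℝ d :=
    fun t x => (2⁻¹ * ‖u t x‖ ^ 2 + p t x) • u t x with hQ_def
  set g : ℝ → UnitAddTorus d → ℝ := fun t x => ⟪f t x, u t x⟫ with hg_def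
  have hu_meas := hsol.1
  have hp_meas := hsol.2.2.1
  have he_meas : AEStronglyMeasurable (Literature.Analysis.FunctionSpaces.Torus.stLift e)
      (volume.restrict (Ioo 0 T ×ˢ univ)) := by
    have : Literature.Analysis.FunctionSpaces.Torus.stLift e =
        fun q => 2⁻¹ * ‖Literature.Analysis.FunctionSpaces.Torus.stLift u q‖ ^ 2 := rfl
    rw [this]
    exact (hu_meas.norm.pow 2).const_mul _
  have hQ_meas : AEStronglyMeasurable (Literature.Analysis.FunctionSpaces.Torus.stLift Q)
      (volume.restrict (Ioo 0 T ×ˢ univ)) := by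
    have : Literature.Analysis.FunctionSpaces.Torus.stLift Q =
        fun q => (2⁻¹ * ‖Literature.Analysis.FunctionSpaces.Torus.stLift u q‖ ^ 2 +
          Literature.Analysis.FunctionSpaces.Torus.stLift p q) •
          Literature.Analysis.FunctionSpaces.Torus.stLift u q := rfl
    rw [this]
    exact (((hu_meas.norm.pow 2).const_mul _).add hp_meas).smul hu_meas
  have hg_meas : AEStronglyMeasurable (Literature.Analysis.FunctionSpaces.Torus.stLift g)
      (volume.restrict (Ioo 0 T ×ˢ univ)) := by
    have : Literature.Analysis.FunctionSpaces.Torus.stLift g =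
        fun q => ⟪Literature.Analysis.FunctionSpaces.Torus.stLift f q,
          Literature.Analysis.FunctionSpaces.Torus.stLift u q⟫ := rfl
    rw [this]
    exact hf_meas.inner hu_meas
  have he : ∀ δ : ℝ, 0 < δ → ∃ M : ℝ,
      ∀ᵐ z ∂(volume.restrict (Icc δ (T - δ) ×ˢ univ)), |e z.1 z.2| ≤ M := by
    intro δ hδ
    obtain ⟨M, hM⟩ := hu δ hδ
    refine ⟨2⁻¹ * M ^ 2, hM.mono fun z hz => ?_⟩
    have h0 : 0 ≤ ‖u z.1 z.2‖ := norm_nonneg _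
    have h1 : ‖u z.1 z.2‖ ^ 2 ≤ M ^ 2 := pow_le_pow_left₀ h0 hz 2
    rw [he_def, abs_of_nonneg (by positivity)]
    linarith
  have hQ : ∀ δ : ℝ, 0 < δ → ∃ M : ℝ,
      ∀ᵐ z ∂(volume.restrict (Icc δ (T - δ) ×ˢ univ)), ‖Q z.1 z.2‖ ≤ M := by
    intro δ hδ
    obtain ⟨M, hM⟩ := hu δ hδ
    obtain ⟨M', hM'⟩ := hp δ hδ
    refine ⟨(2⁻¹ * M ^ 2 + M') * M, (hM.and hM').mono fun z hz => ?_⟩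
    obtain ⟨hzu, hzp⟩ := hz
    have h0 : 0 ≤ ‖u z.1 z.2‖ := norm_nonneg _
    have hM'0 : 0 ≤ M' := (abs_nonneg _).trans hzp
    have h1 : ‖u z.1 z.2‖ ^ 2 ≤ M ^ 2 := pow_le_pow_left₀ h0 hzu 2
    have h2 : |2⁻¹ * ‖u z.1 z.2‖ ^ 2 + p z.1 z.2| ≤ 2⁻¹ * M ^ 2 + M' := by
      calc |2⁻¹ * ‖u z.1 z.2‖ ^ 2 + p z.1 z.2|
          ≤ |2⁻¹ * ‖u z.1 z.2‖ ^ 2| + |p z.1 z.2| := abs_add_le _ _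
        _ ≤ 2⁻¹ * M ^ 2 + M' := by
          rw [abs_of_nonneg (by positivity)]
          exact add_le_add (by linarith) hzp
    rw [hQ_def, norm_smul, Real.norm_eq_abs]
    exact mul_le_mul h2 hzu h0 (by positivity)
  have hg : ∀ δ : ℝ, 0 < δ → ∃ M : ℝ,
      ∀ᵐ z ∂(volume.restrict (Icc δ (T - δ) ×ˢ univ)), |g z.1 z.2| ≤ M := by
    intro δ hδ
    obtain ⟨M, hM⟩ := hu δ hδ
    obtain ⟨N, hN⟩ := hf δ hδ
    refine ⟨N * M, (hM.and hN).mono fun z hz => ?_⟩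
    obtain ⟨hzu, hzf⟩ := hz
    rw [hg_def]
    calc |⟪f z.1 z.2, u z.1 z.2⟫| ≤ ‖f z.1 z.2‖ * ‖u z.1 z.2‖ := abs_real_inner_le_norm _ _
      _ ≤ N * M := mul_le_mul hzf hzu (norm_nonneg _) ((norm_nonneg _).trans hzf)
  refine h d (le_trans (by norm_num) hd) T e Q g he_meas hQ_meas hg_meas he hQ hg μ hμ ?_
  intro ψ hψ
  have hb := hbal ψ hψ
  have hfun : (fun t => ∫ x, (e t x * Literature.Analysis.FunctionSpaces.Torus.timeDeriv ψ t x +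
        ⟪Q t x, Literature.Analysis.FunctionSpaces.Torus.gradient (ψ t) x⟫ + g t x * ψ t x)) =
      fun t => ∫ x, (2⁻¹ * ‖u t x‖ ^ 2 * Literature.Analysis.FunctionSpaces.Torus.timeDeriv ψ t x +
        (2⁻¹ * ‖u t x‖ ^ 2 + p t x) *
          ⟪u t x, Literature.Analysis.FunctionSpaces.Torus.gradient (ψ t) x⟫ +
        ⟪f t x, u t x⟫ * ψ t x) := by
    funext t
    congr 1
    funext x
    simp only [he_def, hQ_def, hg_def, real_inner_smul_left]
  rw [hfun]
  exact hb

end Literature.Barriers.AnomalousDissipation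

end
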